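import Mathlib.AlgebraicGeometry.EllipticCurve.DivisionPolynomial.Degree
import Mathlib.AlgebraicGeometry.EllipticCurve.Jacobian.Point
import Mathlib.RingTheory.Norm.Basic
import Mathlib.FieldTheory.IsAlgClosed.AlgebraicClosure
import Mathlib.Algebra.Module.Torsion.Basic
import Mathlib.Data.Nat.Factorization.Induction
import HarnessLib

/-!
# Torsion points, division polynomials and multiplication polynomials: finiteness of `E(L)[n]`

Trunk T-ELLARITH; serves the named fact `WeierstrassCurve.finite_torsionPoints` of
`Literature.NumberTheory.EllipticCurves.GaloisAction` (Silverman, *AEC*, Cor. III.6.4: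
`E[m]` is finite of order dividing `m²` for `m ≠ 0`).

**Main result (proved, sorry-free, no named-fact hypothesis):**
`WeierstrassCurve.finite_torsionBy_baseChange W L hn : Finite ((W.baseChange L).toAffine.Point[n])`
for an elliptic curve `W` over a field `F`, any field extension `L/F` and `n ≠ 0` — this is
`finite_torsionPoints W L` unfolded — via `WeierstrassCurve.finite_torsionBy_of_isAlgClosed`
(the case of an algebraically closed field) and the injection `E(L) ↪ E(L̄)`.

Silverman proves III.6.4 through the theory of isogenies (II.2, III.4, III.6: degrees, the dual
isogeny), none of which is in Mathlib; his elementary alternative, Exercise 3.7 (division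
polynomials: `[n]P = (φₙ/ψₙ², ωₙ/ψₙ³)`, so `ψₙ` vanishes exactly on `E[n] ∖ O`), is not in Mathlib
either (Mathlib has `ψₙ`, `ΨSqₙ`, `Φₙ` with degrees, but not the multiplication formula). The proof
given here is elementary and self-contained on top of Mathlib's group law:

## The unconditional proof (second half of the file)

Let `V` be an elliptic curve over an algebraically closed field `K`.
1. *Generic multiplication polynomials.* Mathlib's Jacobian coordinates come with polynomial
   doubling and chord formulas `dblXYZ`, `addXYZ` (`Mathlib.AlgebraicGeometry.EllipticCurve.Jacobian`)
   that commute with ring maps. Iterating them (`WeierstrassCurve.Jacobian.smulXYZ`) on the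
   universal point `[X : Y : 1]` over `K[X][Y]` gives triples `(Xₙ, Yₙ, Zₙ)` of bivariate
   polynomials (`WeierstrassCurve.smulPoly`) which specialise, at every affine point `P` with
   `kP ≠ O` for `2 ≤ k ≤ n - 2` ("generic"), to a representative of `nP`
   (`Jacobian.nonsingular_smulXYZ`; genericity guarantees that Mathlib's case split `add = addXYZ`
   is taken at each step). Hence for generic `P = (x, y)`: `nP = O ↔ Zₙ(x, y) = 0`
   (`Jacobian.smul_toAffine_eq_zero_iff`, `evalEval_smulPoly`).
2. *Zeros of a nonzero function are finite* (`finite_setOf_evalEval_eq_zero`): for `g ∈ K[X][Y]`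
   nonzero in the coordinate ring `K[E]` (a domain, free of rank `2` over `K[X]` — Mathlib), the norm
   `N_{K[E]/K[X]}(g) ∈ K[X]` is nonzero and vanishes at the abscissa of every zero of `g` on `E`.
3. *`[p] ≠ 0`* (`exists_smul_ne_zero`, Silverman III.4.2(a) as printed): a point of order `2`
   (root of `Ψ₂Sq`) is not killed by odd `p`; a non-root of `Ψ₂Sq ≠ 0` is not killed by `2`; in
   characteristic `2` without `2`-torsion, roots/non-roots of `Ψ₃` handle `p ≠ 3` / `p = 3`
   ("triplication formula"; the cases `n = 2, 3` of Exercise 3.7(f) are *proved* here from Mathlib's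
   group law: `two_smul_some_eq_zero_iff`, `three_smul_some_eq_zero_iff`).
4. *Induction* (`finite_torsionBy_of_isAlgClosed`): `A[ab]` is finite if `A[a]`, `A[b]` are
   (`Literature.NumberTheory.EllipticCurves.finite_torsionBy_mul`); for a prime `p`, with `B = ⋃_{2≤k≤p-2} E[k]` finite by induction,
   `E[p] ⊆ {O} ∪ B ∪ {Z_p = 0}`, and `Z_p ≠ 0` in `K[E]`: otherwise every point outside `B` is
   `p`-torsion, so `E[p]` has finite complement in the infinite group `E(K)` (`infinite_point`),
   hence `E[p] = E(K)` (`Literature.NumberTheory.EllipticCurves.AddSubgroup.eq_top_of_finite_compl`), contradicting (3).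
5. Descent from `L̄` to `L` along `E(L) ↪ E(L̄)` (`Affine.Point.map_injective`).

## The vendored facts (first half of the file, kept from the first versions)

* Exercise 3.7(d)/(f) as the named fact `WeierstrassCurve.zsmul_eq_zero_iff_evalEval_ψ V`
  (`n • P = 0 ↔ ψₙ(P) = 0` for affine `P`), with the conditional reduction of finiteness to it
  (`finite_torsionBy_of_ΨSq_ne_zero`, `ΨSq_ne_zero_of_prime`, `finite_torsionBy_point_of_isAlgClosed`,
  `finite_torsionBy_point`) — now superseded by the unconditional theorems but kept for their users;
* Exercise 3.7(c) (`Φₙ`, `ΨSqₙ` coprime) as `WeierstrassCurve.isCoprime_Φ_ΨSq` with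
  `isCoprime_Φ_ΨSq.ΨSq_ne_zero`, `finite_torsionBy_point_of_ψ` (originally proposal p4753 of the
  `module_free_tateModule` fact, which this file's first version superseded in a concurrent accept);
* the sanity checks `two_smul_some_eq_zero_iff`, `three_smul_some_eq_zero_iff` (used in step 3).

## References

* J. H. Silverman, *The Arithmetic of Elliptic Curves*, 2nd ed., GTM 106, Springer 2009:
  Group Law Algorithm III.2.3, Exercise 3.7 (division polynomials), Prop. III.4.2(a) (`[m] ≠ 0`,
  p. 68 of the held text), Cor. III.6.4 (p. 81). [SilvermanAEC2009]

## Design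

* Deliberate dot-notation extensions in `namespace WeierstrassCurve` / `WeierstrassCurve.Jacobian`;
  generic group-theoretic glue in `namespace Literature`. A generic `[DecidableEq K]` is used (Mathlib's
  group law on `Affine.Point` needs one); files working under `open scoped Classical` instantiate it
  classically.
* `WeierstrassCurve.instIsEllipticBaseChange`: Mathlib has the instance for `W.map f` but
  `W.baseChange A = W.map (algebraMap R A)` is a `def`, so the instance is restated for it.
* `Jacobian.smulXYZ` uses the naive iteration `(n+1)P = nP + P` (not double-and-add): only
  naturality and generic correctness are needed, never efficiency.
-/

noncomputable section

open Polynomial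
open scoped Polynomial.Bivariate AddSubgroup

universe u v

/-! ## Generic glue: finiteness of torsion subgroups -/

namespace Literature.NumberTheory.EllipticCurves

section Torsion

variable {A : Type u} {B : Type v} [AddCommGroup A] [AddCommGroup B]

/-- Membership in the `n`-torsion subgroup `A[n]`: `a ∈ A[n] ↔ n • a = 0`. [folklore] -/
theorem mem_torsionBy_iff {n : ℤ} {a : A} : a ∈ A[n] ↔ n • a = 0 :=
  Submodule.mem_torsionBy_iff n a

/-- If `f : A →+ B` is injective and `B[n]` is finite then `A[n]` is finite. [folklore] -/
theorem finite_torsionBy_of_injective (f : A →+ B) (hf : Function.Injective f) (n : ℤ)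
    (hB : Finite (B[n])) : Finite (A[n]) := by
  refine Finite.of_injective (fun a : A[n] => (⟨f a, ?_⟩ : B[n])) ?_
  · rw [mem_torsionBy_iff, ← map_zsmul f, mem_torsionBy_iff.mp a.2, map_zero]
  · intro a b h
    exact Subtype.ext (hf (congrArg Subtype.val h))

/-- `A[a * b]` is finite if `A[a]` and `A[b]` are: the map `P ↦ b • P` sends `A[a * b]` to `A[a]`
and its fibres are translates of subsets of `A[b]`. [folklore] -/
theorem finite_torsionBy_mul {a b : ℤ} (ha : Finite (A[a])) (hb : Finite (A[b])) :
    Finite (A[a * b]) := by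
  have hpre : ((fun P : A => b • P) ⁻¹' (A[a] : Set A)).Finite := by
    refine Set.Finite.preimage' (Set.toFinite _) fun Q _ => ?_
    by_cases hQ : ∃ P₀ : A, b • P₀ = Q
    · obtain ⟨P₀, rfl⟩ := hQ
      refine ((Set.toFinite (A[b] : Set A)).image fun T => P₀ + T).subset ?_
      intro P hP
      refine ⟨P - P₀, ?_, add_sub_cancel P₀ P⟩
      rw [SetLike.mem_coe, mem_torsionBy_iff, smul_sub, show b • P = b • P₀ from hP, sub_self]
    · exact Set.finite_empty.subset fun P hP => (hQ ⟨P, hP⟩).elim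
  have hcarrier : (A[a * b] : Set A) = (fun P : A => b • P) ⁻¹' (A[a] : Set A) := by
    ext P
    simp only [SetLike.mem_coe, Set.mem_preimage, mem_torsionBy_iff, mul_smul]
  exact (hcarrier ▸ hpre).to_subtype

/-- `A[1]` is trivial, hence finite. [folklore] -/
theorem finite_torsionBy_one : Finite (A[(1 : ℤ)]) := by
  haveI : Subsingleton (A[(1 : ℤ)]) := ⟨fun P Q => Subtype.ext <| by
    rw [← one_zsmul (P : A), ← one_zsmul (Q : A), mem_torsionBy_iff.mp P.2,
      mem_torsionBy_iff.mp Q.2]⟩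
  infer_instance

end Torsion

end Literature.NumberTheory.EllipticCurves

namespace WeierstrassCurve

/-- The base change of an elliptic curve is an elliptic curve (Mathlib has the instance for
`W.map f`; `W.baseChange A` is by definition `W.map (algebraMap R A)`).
Silverman, *AEC*, III.§1. [folklore] -/
instance instIsEllipticBaseChange {R : Type u} [CommRing R] (W : WeierstrassCurve R) [W.IsElliptic]
    (A : Type v) [CommRing A] [Algebra R A] : (W.baseChange A).IsElliptic :=
  inferInstanceAs (W.map (algebraMap R A)).IsElliptic

variable {K : Type u} [Field K] (V : WeierstrassCurve K)

/-! ## `ψₙ² = ΨSqₙ(x)` on the curve -/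

/-- On an affine point `(x, y)` of `V` the square of the `n`-division polynomial is the value of
the univariate polynomial `ΨSqₙ`: `ψₙ(x, y)² = ΨSqₙ(x)` (Mathlib: `ψₙ ≡ Ψₙ` and `Ψₙ² ≡ ΨSqₙ` in the
coordinate ring). Silverman, *AEC*, Exercise 3.7(a). [folklore] -/
theorem evalEval_ψ_sq {x y : K} (h : V.toAffine.Equation x y) (n : ℤ) :
    (V.ψ n).evalEval x y ^ 2 = (V.ΨSq n).eval x := by
  have e := congrArg (AdjoinRoot.evalEval h)
    ((congrArg (· ^ 2) (Affine.CoordinateRing.mk_ψ V n)).trans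
      (Affine.CoordinateRing.mk_Ψ_sq V n))
  simpa only [map_pow, AdjoinRoot.evalEval_mk, evalEval_C] using e

/-! ## Exercise 3.7(c): `φₙ` and `ψₙ²` are coprime -/

/-- **Silverman, AEC, Exercise 3.7(c)** (numerator and denominator of `x ∘ [n]` are coprime).
"If `Δ ≠ 0`, prove that `φₘ(x)` and `ψₘ(x)²` are relatively prime polynomials in `K[x]`." Here
`φₘ(x)` and `ψₘ(x)²`, regarded as polynomials in `x` alone via `(2y + a₁x + a₃)² ↦ 4x³ + b₂x² + 2b₄x + b₆`
(Exercise 3.7(a)), are Mathlib's univariate `WeierstrassCurve.Φ m` and `WeierstrassCurve.ΨSq m`;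
`Δ ≠ 0` over a field is `IsElliptic`; stated for all `m : ℤ` (`Φ₀ = 1`; `Φ₋ₘ = Φₘ`, `ΨSq₋ₘ = ΨSqₘ`).
Together with 3.7(d) this gives `deg [m] = m²` (3.7(e)). This restates, under the same name, the
fact vendored by proposal p4753 (agent `…module_free_tateModule-0`) which an unrelated concurrent
proposal of this file superseded. [cite: SilvermanAEC2009, Exercise 3.7(c)] -/
def isCoprime_Φ_ΨSq : Prop :=
  ∀ [V.IsElliptic] (n : ℤ), IsCoprime (V.Φ n) (V.ΨSq n)

variable {V} in
/-- Given Exercise 3.7(c), `ΨSqₙ ≠ 0` for `n ≠ 0` over any field (a polynomial coprime to `0` is a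
unit, but `deg Φₙ = n² > 0`). Silverman, *AEC*, Exercise 3.7(b),(c). [folklore] -/
theorem isCoprime_Φ_ΨSq.ΨSq_ne_zero (hc : V.isCoprime_Φ_ΨSq) [V.IsElliptic] {n : ℤ} (hn : n ≠ 0) :
    V.ΨSq n ≠ 0 := by
  intro h0
  have h1 : IsUnit (V.Φ n) := by
    have := hc n
    rw [h0] at this
    exact isCoprime_zero_right.mp this
  have h2 := natDegree_eq_zero_of_isUnit h1
  rw [V.natDegree_Φ n] at h2
  exact hn (Int.natAbs_eq_zero.mp ((pow_eq_zero_iff two_ne_zero).mp h2))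

variable [DecidableEq K]

/-! ## The named fact: `ψₙ` vanishes exactly at the nontrivial `n`-torsion points -/

/-- **Silverman, AEC, Exercise 3.7(d),(f)** (division polynomials detect torsion). Let `E/K` be an
elliptic curve given by a Weierstrass equation with `Δ ≠ 0`, and let `ψₙ ∈ ℤ[a₁, …, a₆, x, y]` be
the `n`-th division polynomial. Then for every point `P = (x₀, y₀) ∈ E`,
`[m]P = (φₘ(P)/ψₘ(P)², ωₘ(P)/ψₘ(P)³)` (3.7(d)), and "`ψₙ` vanishes at precisely the nontrivial
`n`-torsion points" (3.7(f)). Vendored here in the form consumed downstream: for an affine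
(nonsingular) point `P = (x, y)` of an elliptic curve `V` over a field `K` and `n : ℤ`,
`n • P = 0 ↔ ψₙ(x, y) = 0` (for `n ≤ 0` this is the same statement via `ψ₋ₙ = -ψₙ`, `ψ₀ = 0`).
Mathlib's `WeierstrassCurve.ψ` is Silverman's `ψₙ`. [cite: SilvermanAEC2009, Exercise 3.7(d),(f)] -/
def zsmul_eq_zero_iff_evalEval_ψ : Prop :=
  ∀ [V.IsElliptic] (n : ℤ) {x y : K} (h : V.toAffine.Nonsingular x y),
    n • (Affine.Point.some x y h : V.toAffine.Point) = 0 ↔ (V.ψ n).evalEval x y = 0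

variable {V}

/-- Sanity check of the vendored form of Exercise 3.7(f) in the first nontrivial case `n = 2`
(provable from Mathlib's group law): `2P = O ↔ ψ₂(P) = 2y + a₁x + a₃ = 0`, i.e. an affine point is
`2`-torsion iff it equals its negative `(x, -y - a₁x - a₃)`. Silverman, *AEC*, Group Law
Algorithm III.2.3 and Exercise 3.7. [folklore] -/
theorem two_smul_some_eq_zero_iff {x y : K} (h : V.toAffine.Nonsingular x y) :
    (2 : ℤ) • (Affine.Point.some x y h : V.toAffine.Point) = 0 ↔ (V.ψ 2).evalEval x y = 0 := by
  rw [two_zsmul, add_eq_zero_iff_eq_neg, Affine.Point.neg_some, ψ_two, ψ₂,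
    Affine.evalEval_polynomialY]
  simp only [Affine.Point.some.injEq, true_and, Affine.negY]
  constructor <;> intro h' <;> linear_combination h'

/-- The duplication formula against `Ψ₃`: for an affine point `(x, y)` with `2P ≠ O`
(`y ≠ -y - a₁x - a₃`), `(x(2P) - x) · (2y + a₁x + a₃)² = -Ψ₃(x)`, i.e.
`x(2P) - x = -ψ₃ψ₁/ψ₂²` (`φ₂ = xψ₂² - ψ₃ψ₁`). Silverman, *AEC*, Group Law Algorithm III.2.3(d) and
Exercise 3.7. [folklore] -/
theorem addX_self_sub_mul_sq {x y : K} (h : V.toAffine.Equation x y)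
    (hy : y ≠ V.toAffine.negY x y) :
    (V.toAffine.addX x x (V.toAffine.slope x x y y) - x) * (y - V.toAffine.negY x y) ^ 2 =
      -(V.Ψ₃.eval x) := by
  have hd : y - V.toAffine.negY x y ≠ 0 := sub_ne_zero.mpr hy
  rw [Affine.slope_of_Y_ne rfl hy]
  rw [Affine.negY] at hd ⊢
  rw [Affine.addX, Ψ₃]
  simp only [eval_add, eval_mul, eval_pow, eval_C, eval_X, eval_ofNat, b₂, b₄, b₆, b₈]
  have heq := (Affine.equation_iff ..).mp h
  set n := 3 * x ^ 2 + 2 * V.a₂ * x + V.a₄ - V.a₁ * y with hn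
  set d := y - (-y - V.a₁ * x - V.a₃) with hdd
  have e1 : ((n / d) ^ 2 + V.toAffine.a₁ * (n / d) - V.toAffine.a₂ - x - x - x) * d ^ 2 =
      n ^ 2 + V.a₁ * n * d - (V.a₂ + 3 * x) * d ^ 2 := by
    field_simp
    ring
  rw [e1, hn, hdd]
  linear_combination (-(V.a₁ ^ 2 + 4 * V.a₂ + 12 * x)) * heq

/-- Sanity check of the vendored form of Exercise 3.7(f) for `n = 3` (provable from Mathlib's group
law) at points that are not `2`-torsion: `3P = O ↔ ψ₃(P) = Ψ₃(x) = 3x⁴ + b₂x³ + 3b₄x² + 3b₆x + b₈ = 0`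
(`3P = O ↔ 2P = -P ↔ x(2P) = x(P)`, and `x(2P) - x = -Ψ₃(x)/(2y + a₁x + a₃)²`).
Silverman, *AEC*, Exercise 3.7 (and III.2.3(d)). [folklore] -/
theorem three_smul_some_eq_zero_iff {x y : K} (h : V.toAffine.Nonsingular x y)
    (hy : y ≠ V.toAffine.negY x y) :
    (3 : ℤ) • (Affine.Point.some x y h : V.toAffine.Point) = 0 ↔ (V.ψ 3).evalEval x y = 0 := by
  set P : V.toAffine.Point := Affine.Point.some x y h with hP
  have hd : y - V.toAffine.negY x y ≠ 0 := sub_ne_zero.mpr hy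
  have key := V.addX_self_sub_mul_sq h.left hy
  have h3 : (3 : ℤ) • P = P + P + P := by
    rw [show (3 : ℤ) = 1 + 1 + 1 by norm_num, add_zsmul, add_zsmul, one_zsmul]
  rw [h3, add_eq_zero_iff_eq_neg, ψ_three, evalEval_C]
  have h2P : P + P = _ := Affine.Point.add_self_of_Y_ne (h₁ := h) hy
  constructor
  · intro hPP
    rw [h2P, hP, Affine.Point.neg_some, Affine.Point.some.injEq] at hPP
    have := key
    rw [hPP.1, sub_self, zero_mul, zero_eq_neg] at this
    exact this
  · intro hΨ
    rw [hΨ, neg_zero, mul_eq_zero, pow_eq_zero_iff two_ne_zero] at key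
    have hx : V.toAffine.addX x x (V.toAffine.slope x x y y) = x :=
      sub_eq_zero.mp (key.resolve_right hd)
    rcases (Affine.Point.X_eq_iff (h₁ := Affine.nonsingular_add h h fun hxy => hy hxy.right)
      (h₂ := h)).mp hx with h1 | h1
    · rw [← h2P] at h1
      exact (Affine.Point.some_ne_zero h (add_eq_left.mp h1)).elim
    · rw [← h2P] at h1
      exact h1

/-! ## Consequences: finiteness of `E(K)[n]` -/

/-- Given Exercise 3.7(f), the `x`-coordinate of an affine `n`-torsion point is a root of `ΨSqₙ`.
Silverman, *AEC*, Exercise 3.7(f). [folklore] -/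
theorem isRoot_ΨSq_of_zsmul_eq_zero [V.IsElliptic] (hψ : V.zsmul_eq_zero_iff_evalEval_ψ) {n : ℤ}
    {x y : K} {h : V.toAffine.Nonsingular x y}
    (hP : n • (Affine.Point.some x y h : V.toAffine.Point) = 0) : (V.ΨSq n).IsRoot x := by
  rw [IsRoot.def, ← V.evalEval_ψ_sq h.left n, (hψ n h).mp hP, zero_pow two_ne_zero]

/-- Given Exercise 3.7(f), if the univariate polynomial `ΨSqₙ` of an elliptic curve `V/K` is
nonzero then `E(K)[n]` is finite (its nonzero points have `x` among the roots of `ΨSqₙ` and `y`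
among the two roots of the Weierstrass quadratic above `x`). Silverman, *AEC*, Exercise 3.7(f) and
Cor. III.6.4. [folklore] -/
theorem finite_torsionBy_of_ΨSq_ne_zero [V.IsElliptic] (hψ : V.zsmul_eq_zero_iff_evalEval_ψ)
    {n : ℤ} (hΨ : V.ΨSq n ≠ 0) : Finite (V.toAffine.Point[n]) := by
  -- the Weierstrass polynomial in `Y` above a fixed `x`
  set q : K → K[X] := fun x => V.toAffine.polynomial.map (evalRingHom x) with hq
  have hq0 : ∀ x, q x ≠ 0 := fun x => (V.toAffine.monic_polynomial.map _).ne_zero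
  set S : Set (K × K) := {xy | (V.ΨSq n).IsRoot xy.1 ∧ (q xy.1).IsRoot xy.2} with hS
  have hSfin : S.Finite := by
    refine ((finite_setOf_isRoot hΨ).biUnion fun x _ =>
      (finite_setOf_isRoot (hq0 x)).image (Prod.mk x)).subset ?_
    rintro ⟨x, y⟩ ⟨hx, hy⟩
    exact Set.mem_biUnion hx ⟨y, hy, rfl⟩
  let g : V.toAffine.Point[n] → Option (K × K) := fun P =>
    match P.1 with
    | .zero => none
    | .some x y _ => some (x, y)
  have hg : Function.Injective g := by
    rintro ⟨_ | ⟨x, y, h⟩, hP⟩ ⟨_ | ⟨x', y', h'⟩, hP'⟩ hPP'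
    · rfl
    · simp [g] at hPP'
    · simp [g] at hPP'
    · simp only [g, Option.some.injEq, Prod.mk.injEq] at hPP'
      obtain ⟨rfl, rfl⟩ := hPP'
      rfl
  set T : Set (Option (K × K)) := insert none (some '' S) with hT
  have hrange : ∀ P, g P ∈ T := by
    rintro ⟨_ | ⟨x, y, h⟩, hP⟩
    · exact Set.mem_insert _ _
    · refine Set.mem_insert_of_mem _ ⟨(x, y), ⟨?_, ?_⟩, rfl⟩
      · exact isRoot_ΨSq_of_zsmul_eq_zero hψ (Literature.NumberTheory.EllipticCurves.mem_torsionBy_iff.mp hP)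
      · change (q x).IsRoot y
        rw [IsRoot.def, hq, map_evalRingHom_eval]
        exact h.left
  haveI : Finite T := ((hSfin.image _).insert _).to_subtype
  exact Finite.of_injective (fun P => (⟨g P, hrange P⟩ : T))
    fun P Q hPQ => hg (congrArg Subtype.val hPQ)

/-- Given Exercise 3.7(f), over an algebraically closed field the polynomial `ΨSq_p` of an
elliptic curve is nonzero for every prime `p` (i.e. `[p] ≠ 0`; for `p = char K` this is
Silverman's argument for Prop. III.4.2(a): `b₂ = b₆ = 0 ⇒ Δ = 0` when `p = 2`, and a point `T` of
order `2` has `pT = T ≠ O` when `p` is odd). Silverman, *AEC*, Prop. III.4.2(a). [folklore] -/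
theorem ΨSq_ne_zero_of_prime [IsAlgClosed K] [V.IsElliptic] (hψ : V.zsmul_eq_zero_iff_evalEval_ψ)
    {p : ℕ} (hp : p.Prime) : V.ΨSq p ≠ 0 := by
  by_cases hpK : (p : K) = 0
  swap
  · exact V.ΨSq_ne_zero (n := p) (by exact_mod_cast hpK)
  rcases hp.eq_two_or_odd' with rfl | hodd
  · -- `p = 2 = char K`: `ΨSq₂ = 4x³ + b₂x² + 2b₄x + b₆ = 0` forces `b₂ = b₆ = 0`, whence `Δ = 0`.
    intro h0
    rw [Nat.cast_ofNat, ΨSq_two] at h0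
    have h2 : (2 : K) = 0 := by exact_mod_cast hpK
    have hb₂ : V.b₂ = 0 := by
      have := congrArg (coeff · 2) h0
      simpa [Ψ₂Sq, coeff_X, coeff_C, coeff_C_mul, coeff_X_pow] using this
    have hb₆ : V.b₆ = 0 := by
      have := congrArg (coeff · 0) h0
      simpa [Ψ₂Sq, coeff_X, coeff_C, coeff_C_mul, coeff_X_pow] using this
    refine V.isUnit_Δ.ne_zero ?_
    rw [Δ, hb₂, hb₆]
    linear_combination (-4 * V.b₄ ^ 3) * h2
  · -- `p = char K` odd: if `ΨSq_p = 0` every affine point is `p`-torsion, but a point of order `2`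
    -- is not.
    obtain ⟨k, hk⟩ := hodd
    have h2 : (2 : K) ≠ 0 := by
      intro h2
      have h1 : (p : K) = 1 := by
        rw [hk]; push_cast; rw [h2]; ring
      exact one_ne_zero (h1.symm.trans hpK)
    have h4 : (4 : K) ≠ 0 := by
      rw [show (4 : K) = 2 * 2 by norm_num]
      exact mul_ne_zero h2 h2
    intro h0
    have htors : ∀ {x y : K} (h : V.toAffine.Nonsingular x y),
        (p : ℤ) • (Affine.Point.some x y h : V.toAffine.Point) = 0 := fun h =>
      (hψ p h).mpr <| (pow_eq_zero_iff two_ne_zero).mp <| by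
        rw [V.evalEval_ψ_sq h.left, h0, eval_zero]
    -- a point `T = (x₀, y₀)` of order `2`
    obtain ⟨x₀, hx₀⟩ : ∃ x₀, V.Ψ₂Sq.IsRoot x₀ := IsAlgClosed.exists_root _ <| by
      rw [degree_eq_natDegree (V.Ψ₂Sq_ne_zero h4), V.natDegree_Ψ₂Sq h4]
      simp
    set y₀ : K := -(V.a₁ * x₀ + V.a₃) / 2 with hy₀
    have hψ₂ : V.ψ₂.evalEval x₀ y₀ = 0 := by
      rw [ψ₂, Affine.evalEval_polynomialY, hy₀]
      field_simp
      ring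
    have heq : V.toAffine.Equation x₀ y₀ := by
      have e := congrArg (Polynomial.evalEval x₀ y₀) V.ψ₂_sq
      simp only [evalEval_pow, evalEval_add, evalEval_mul, evalEval_C, hψ₂] at e
      have h4e : (4 : K[X][Y]).evalEval x₀ y₀ = 4 := evalEval_natCast x₀ y₀ 4
      rw [h4e, hx₀.eq_zero, zero_add, zero_pow two_ne_zero] at e
      exact (mul_eq_zero.mp e.symm).resolve_left h4
    have hns : V.toAffine.Nonsingular x₀ y₀ := Affine.equation_iff_nonsingular.mp heq
    have h2T : (2 : ℤ) • (Affine.Point.some x₀ y₀ hns : V.toAffine.Point) = 0 :=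
      (hψ 2 hns).mpr (by rw [ψ_two]; exact hψ₂)
    have hpT := htors hns
    have hp' : (p : ℤ) = k * 2 + 1 := by rw [hk]; push_cast; ring
    rw [hp', add_smul, one_zsmul, mul_smul, h2T, smul_zero, zero_add] at hpT
    exact Affine.Point.some_ne_zero hns hpT

/-- Given Exercise 3.7(f), `E(K)[n]` is finite for an elliptic curve over an algebraically closed
field `K` and `n ≠ 0`. Silverman, *AEC*, Cor. III.6.4 (`deg [m] = m²`, so `#E[m] ∣ m²`). [folklore] -/
theorem finite_torsionBy_point_of_isAlgClosed [IsAlgClosed K] [V.IsElliptic]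
    (hψ : V.zsmul_eq_zero_iff_evalEval_ψ) {n : ℤ} (hn : n ≠ 0) : Finite (V.toAffine.Point[n]) := by
  suffices H : ∀ m : ℕ, m ≠ 0 → Finite (V.toAffine.Point[(m : ℤ)]) by
    rcases Int.natAbs_eq n with h | h
    · rw [h]; exact H _ (Int.natAbs_ne_zero.mpr hn)
    · rw [h, AddSubgroup.torsionBy.neg]; exact H _ (Int.natAbs_ne_zero.mpr hn)
  intro m
  induction m using Nat.recOnMul with
  | zero => exact fun h => (h rfl).elim
  | one => exact fun _ => by rw [Nat.cast_one]; exact Literature.NumberTheory.EllipticCurves.finite_torsionBy_one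
  | prime p hp => exact fun _ => finite_torsionBy_of_ΨSq_ne_zero hψ (ΨSq_ne_zero_of_prime hψ hp)
  | mul a b ha hb =>
    intro hab
    rw [Nat.cast_mul]
    exact Literature.NumberTheory.EllipticCurves.finite_torsionBy_mul (ha (left_ne_zero_of_mul hab)) (hb (right_ne_zero_of_mul hab))

/-- Given Exercise 3.7(c) and (f) for an elliptic curve `V` over any field `K`, `E(K)[n]` is finite
for `n ≠ 0` (no passage to `K̄` needed: 3.7(c) supplies `ΨSqₙ ≠ 0`). This is the two-hypothesis
reduction of proposal p4753 (`finite_torsionBy_point_of_ψ`), re-proved here.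
Silverman, *AEC*, Cor. III.6.4 and Exercise 3.7(c),(f). [folklore] -/
theorem finite_torsionBy_point_of_ψ [V.IsElliptic] (hψ : V.zsmul_eq_zero_iff_evalEval_ψ)
    (hc : V.isCoprime_Φ_ΨSq) {n : ℤ} (hn : n ≠ 0) : Finite (V.toAffine.Point[n]) :=
  finite_torsionBy_of_ΨSq_ne_zero hψ (hc.ΨSq_ne_zero hn)

/-! ## Descent to an arbitrary field -/

variable {F : Type u} [Field F] (W : WeierstrassCurve F) (L : Type u) [Field L] [Algebra F L]
  [DecidableEq L] [DecidableEq (AlgebraicClosure L)]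

/-- **Finiteness of `E(L)[n]`** (Silverman, AEC, Cor. III.6.4, from Exercise 3.7(f)). Let `W` be
an elliptic curve over a field `F`, `L/F` a field extension and `n ≠ 0`. If the division polynomials
of `W` over `L̄` detect torsion (Exercise 3.7(f), the named fact `zsmul_eq_zero_iff_evalEval_ψ`),
then the `n`-torsion subgroup `E(L)[n]` of the `L`-rational points is finite: `E(L̄)[n]` is finite
by `finite_torsionBy_point_of_isAlgClosed` and `E(L) ↪ E(L̄)`. This is
`WeierstrassCurve.finite_torsionPoints W L` of `GaloisAction.lean`, unfolded.
Silverman, *AEC*, Cor. III.6.4. [folklore] -/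
theorem finite_torsionBy_point [W.IsElliptic]
    (hψ : (W.baseChange (AlgebraicClosure L)).zsmul_eq_zero_iff_evalEval_ψ) {n : ℤ} (hn : n ≠ 0) :
    Finite ((W.baseChange L).toAffine.Point[n]) :=
  Literature.NumberTheory.EllipticCurves.finite_torsionBy_of_injective
    (Affine.Point.map (W' := W.toAffine) (IsScalarTower.toAlgHom F L (AlgebraicClosure L)))
    (Affine.Point.map_injective _) n
    (finite_torsionBy_point_of_isAlgClosed (V := W.baseChange (AlgebraicClosure L)) hψ hn)

end WeierstrassCurve

namespace WeierstrassCurve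

/-! ## Generic multiplication by `n` in Jacobian coordinates -/

namespace Jacobian

variable {R : Type u} {S : Type v} [CommRing R] [CommRing S]

variable (W' : Jacobian R) in
/-- The **generic multiplication-by-`n` representative** of a Jacobian point representative `P`:
`smulXYZ P 0 = [1 : 1 : 0]`, `smulXYZ P 1 = P`, `smulXYZ P 2 = dblXYZ P` (Mathlib's polynomial
doubling formula) and `smulXYZ P (n + 3) = addXYZ (smulXYZ P (n + 2)) P` (Mathlib's polynomial
chord formula). All coordinates are polynomials in the coordinates of `P`; for a *generic* affine
point (`k • P ≠ O` for `2 ≤ k ≤ n - 2`) it represents `n • P` (`nonsingular_smulXYZ`). This is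
the iterated group law of Silverman, *AEC*, Group Law Algorithm III.2.3, in the weighted
projective coordinates of Mathlib's `WeierstrassCurve.Jacobian`. [folklore] -/
noncomputable def smulXYZ (P : Fin 3 → R) : ℕ → Fin 3 → R
  | 0 => ![1, 1, 0]
  | 1 => P
  | 2 => W'.dblXYZ P
  | n + 3 => W'.addXYZ (smulXYZ P (n + 2)) P

variable {W' : Jacobian R}

/-- `smulXYZ P 0 = [1 : 1 : 0]`. [folklore] -/
@[simp] theorem smulXYZ_zero (P : Fin 3 → R) : W'.smulXYZ P 0 = ![1, 1, 0] := rfl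

/-- `smulXYZ P 1 = P`. [folklore] -/
@[simp] theorem smulXYZ_one (P : Fin 3 → R) : W'.smulXYZ P 1 = P := rfl

/-- `smulXYZ P 2 = dblXYZ P`. [folklore] -/
@[simp] theorem smulXYZ_two (P : Fin 3 → R) : W'.smulXYZ P 2 = W'.dblXYZ P := rfl

/-- `smulXYZ P (n + 3) = addXYZ (smulXYZ P (n + 2)) P`. [folklore] -/
theorem smulXYZ_add_three (P : Fin 3 → R) (n : ℕ) :
    W'.smulXYZ P (n + 3) = W'.addXYZ (W'.smulXYZ P (n + 2)) P := rfl

/-- **Naturality**: the generic multiplication-by-`n` representative commutes with ring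
homomorphisms (its coordinates are polynomials with integer structure in the `aᵢ` and the
coordinates of `P`). [folklore] -/
theorem map_smulXYZ (f : R →+* S) (P : Fin 3 → R) :
    ∀ n : ℕ, (W'.map f).smulXYZ (f ∘ P) n = f ∘ W'.smulXYZ P n
  | 0 => by
    rw [smulXYZ_zero, smulXYZ_zero, comp_fin3, map_one, map_zero]
  | 1 => rfl
  | 2 => by rw [smulXYZ_two, smulXYZ_two, map_dblXYZ]
  | n + 3 => by
    rw [smulXYZ_add_three, smulXYZ_add_three, map_smulXYZ f P (n + 2), map_addXYZ]

variable {F : Type u} [Field F] [DecidableEq F] {W : Jacobian F}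

/-- **The generic representative computes `n • P`.** Let `P` be a nonsingular representative of an
affine point (`P z ≠ 0`) of a Weierstrass curve over a field, and suppose `k • P ≠ O` for
`2 ≤ k ≤ n - 2`. Then `smulXYZ P n` is nonsingular and represents `n • P`. (Along the iteration
`smulXYZ P (k + 1) = addXYZ (smulXYZ P k) P` Mathlib's `add` coincides with `addXYZ` because
`k • P ≠ P`.) Silverman, *AEC*, III.2.3. [folklore] -/
theorem nonsingular_smulXYZ {P : Fin 3 → F} (hP : W.Nonsingular P) (hPz : P 2 ≠ 0) :
    ∀ n : ℕ, (∀ k : ℕ, 2 ≤ k → k + 2 ≤ n → k • Point.toAffine W P ≠ 0) →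
      W.Nonsingular (W.smulXYZ P n) ∧
        Point.toAffine W (W.smulXYZ P n) = n • Point.toAffine W P
  | 0 => fun _ => ⟨nonsingular_zero, by rw [smulXYZ_zero, Point.toAffine_zero, zero_smul]⟩
  | 1 => fun _ => ⟨hP, by rw [smulXYZ_one, one_smul]⟩
  | 2 => fun _ => ⟨by rw [smulXYZ_two, ← add_self]; exact nonsingular_add hP hP,
      by rw [smulXYZ_two, ← add_self, Point.toAffine_add hP hP, two_smul]⟩
  | n + 3 => fun hk => by
    obtain ⟨hns, hto⟩ := nonsingular_smulXYZ hP hPz (n + 2) fun k hk2 hkn => hk k hk2 (by omega)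
    have hne : ¬W.smulXYZ P (n + 2) ≈ P := by
      intro h
      have h1 := Point.toAffine_of_equiv (W := W) h
      rw [hto] at h1
      -- `(n + 2) • A = A`, hence `(n + 1) • A = 0`
      replace h1 : (n + 1) • Point.toAffine W P = 0 :=
        add_eq_right.mp (by rw [← succ_nsmul]; exact h1)
      rcases n with _ | n
      · rw [zero_add, one_smul, Point.toAffine_of_Z_ne_zero hP hPz] at h1
        exact Affine.Point.some_ne_zero _ h1
      · exact hk (n + 2) (by omega) (by omega) h1
    rw [smulXYZ_add_three, ← add_of_not_equiv hne]
    refine ⟨nonsingular_add hns hP, ?_⟩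
    rw [Point.toAffine_add hns hP, hto]
    exact (succ_nsmul _ _).symm

/-- **Generic points: `n • P = O ↔ Z(smulXYZ P n) = 0`.** For a nonsingular representative `P` of
an affine point with `k • P ≠ O` for `2 ≤ k ≤ n - 2`, the point `n • P` is `O` iff the
`Z`-coordinate of the generic representative vanishes. Silverman, *AEC*, III.2.3. [folklore] -/
theorem smul_toAffine_eq_zero_iff {P : Fin 3 → F} (hP : W.Nonsingular P) (hPz : P 2 ≠ 0) (n : ℕ)
    (hk : ∀ k : ℕ, 2 ≤ k → k + 2 ≤ n → k • Point.toAffine W P ≠ 0) :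
    n • Point.toAffine W P = 0 ↔ W.smulXYZ P n 2 = 0 := by
  obtain ⟨hns, hto⟩ := nonsingular_smulXYZ hP hPz n hk
  rw [← hto]
  refine ⟨fun h0 => ?_, fun hz => Point.toAffine_of_Z_eq_zero hz⟩
  by_contra hz
  rw [Point.toAffine_of_Z_ne_zero hns hz] at h0
  exact Affine.Point.some_ne_zero _ h0

end Jacobian

/-! ## The universal multiplication polynomials -/

section smulPoly

variable {R : Type u} [CommRing R] (V : WeierstrassCurve R)

/-- The **universal multiplication-by-`n` triple** `(Xₙ, Yₙ, Zₙ) ∈ R[X][Y]³` of a Weierstrass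
curve `V/R`: the generic representative `smulXYZ` of the universal point `[X : Y : 1]` over the
polynomial ring `R[X][Y]`. Its specialisation at `(x, y)` is `smulXYZ [x : y : 1] n`
(`evalEval_smulPoly`), so `Zₙ(x, y) = 0` cuts out the `n`-torsion among generic affine points.
(These play the role of Silverman's `(φₙψₙ, ωₙ, ψₙ)`, *AEC*, Exercise 3.7, without the
normalisation.) [folklore] -/
noncomputable def smulPoly (n : ℕ) : Fin 3 → R[X][Y] :=
  Jacobian.smulXYZ (V.map (algebraMap R R[X][Y])) ![C X, Y, 1] n

/-- Specialisation of the universal multiplication triple at `(x, y)` is the generic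
representative of `[x : y : 1]`. [folklore] -/
theorem evalEval_smulPoly (x y : R) (n : ℕ) :
    (fun i => (V.smulPoly n i).evalEval x y) = Jacobian.smulXYZ V ![x, y, 1] n := by
  have hcomp : (evalEvalRingHom x y).comp (algebraMap R R[X][Y]) = RingHom.id R := by
    ext r
    simp [coe_algebraMap_eq_CC]
  have hP : (⇑(evalEvalRingHom x y)) ∘ (![C X, Y, 1] : Fin 3 → R[X][Y]) = ![x, y, 1] := by
    rw [Jacobian.comp_fin3]
    simp
  have := Jacobian.map_smulXYZ (W' := V.map (algebraMap R R[X][Y])) (evalEvalRingHom x y)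
    ![C X, Y, 1] n
  dsimp only [Jacobian.map] at this
  rw [map_map, hcomp, map_id, hP] at this
  rw [this]
  rfl

/-- Specialisation of the universal multiplication triple, coordinatewise. [folklore] -/
theorem evalEval_smulPoly_apply (x y : R) (n : ℕ) (i : Fin 3) :
    (V.smulPoly n i).evalEval x y = Jacobian.smulXYZ V ![x, y, 1] n i :=
  congrFun (V.evalEval_smulPoly x y n) i

end smulPoly

/-! ## Zeros of a nonzero function on the curve -/

variable {K : Type u} [Field K] (V : WeierstrassCurve K)

/-- **A nonzero element of the coordinate ring `K[E]` has finitely many zeros.** If `g ∈ K[X][Y]`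
is nonzero modulo the Weierstrass polynomial, the affine points `(x, y)` of `V` with `g(x, y) = 0`
form a finite set: writing `g ≡ p + qY` (Mathlib's basis `{1, Y}` of `K[E]` over `K[X]`), the norm
`N = p² - pq(a₁X + a₃) - q²(X³ + a₂X² + a₄X + a₆) ∈ K[X]` (Mathlib's `norm_smul_basis`) is
nonzero and vanishes at the abscissa of every zero of `g` on the curve. (Silverman, *AEC*, II.§1–2:
a nonconstant function on a curve has finitely many zeros.) [folklore] -/
theorem finite_setOf_evalEval_eq_zero {g : K[X][Y]} (hg : Affine.CoordinateRing.mk V g ≠ 0) :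
    {P : V.toAffine.Point | ∃ x y : K, ∃ h : V.toAffine.Nonsingular x y,
      P = .some x y h ∧ g.evalEval x y = 0}.Finite := by
  classical
  obtain ⟨p, q, hpq⟩ :=
    Affine.CoordinateRing.exists_smul_basis_eq (Affine.CoordinateRing.mk V g)
  set N : K[X] := Algebra.norm K[X] (Affine.CoordinateRing.mk V g) with hN
  have hN0 : N ≠ 0 :=
    (Algebra.norm_ne_zero_iff_of_basis (Affine.CoordinateRing.basis V)).mpr hg
  have hNpq : N = p ^ 2 - p * q * (C V.a₁ * X + C V.a₃) -
      q ^ 2 * (X ^ 3 + C V.a₂ * X ^ 2 + C V.a₄ * X + C V.a₆) := by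
    rw [hN, ← hpq, Affine.CoordinateRing.norm_smul_basis]
  -- `g ≡ p + qY` modulo the Weierstrass polynomial
  have hdvd : V.toAffine.polynomial ∣ g - (C p + C q * Y) := by
    rw [← AdjoinRoot.mk_eq_mk]
    change Affine.CoordinateRing.mk V g = Affine.CoordinateRing.mk V _
    rw [← hpq, map_add, map_mul, Affine.CoordinateRing.smul, Affine.CoordinateRing.smul, mul_one]
  -- at a zero `(x, y)` of `g` on the curve, `p(x) + q(x)y = 0`, hence `N(x) = 0`
  have hroot : ∀ {x y : K}, V.toAffine.Equation x y → g.evalEval x y = 0 → N.IsRoot x := by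
    intro x y hxy hg0
    have h1 : p.eval x + q.eval x * y = 0 := by
      have e := evalEval_dvd x y hdvd
      have hxy' : V.toAffine.polynomial.evalEval x y = 0 := hxy
      rw [hxy', zero_dvd_iff, evalEval_sub, hg0, zero_sub, neg_eq_zero, evalEval_add,
        evalEval_mul, evalEval_C, evalEval_C, evalEval_X] at e
      exact e
    have heq := (Affine.equation_iff ..).mp hxy
    have hp : p.eval x = -(q.eval x * y) := eq_neg_of_add_eq_zero_left h1
    rw [IsRoot.def, hNpq]
    simp only [eval_sub, eval_mul, eval_pow, eval_add, eval_C, eval_X, hp]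
    linear_combination (q.eval x) ^ 2 * heq
  -- candidate coordinates: `x` a root of `N`, `y` a root of the Weierstrass quadratic above `x`
  set qx : K → K[X] := fun x => V.toAffine.polynomial.map (evalRingHom x) with hqx
  have hq0 : ∀ x, qx x ≠ 0 := fun x => (V.toAffine.monic_polynomial.map _).ne_zero
  set S : Set (K × K) := {xy | N.IsRoot xy.1 ∧ (qx xy.1).IsRoot xy.2} with hS
  have hSfin : S.Finite := by
    refine ((finite_setOf_isRoot hN0).biUnion fun x _ =>
      (finite_setOf_isRoot (hq0 x)).image (Prod.mk x)).subset ?_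
    rintro ⟨x, y⟩ ⟨hx, hy⟩
    exact Set.mem_biUnion hx ⟨y, hy, rfl⟩
  let f : K × K → V.toAffine.Point := fun xy =>
    if h : V.toAffine.Nonsingular xy.1 xy.2 then .some xy.1 xy.2 h else 0
  refine (hSfin.image f).subset ?_
  rintro P ⟨x, y, h, rfl, hg0⟩
  refine ⟨(x, y), ⟨hroot h.left hg0, ?_⟩, ?_⟩
  · change (qx x).IsRoot y
    rw [IsRoot.def, hqx, map_evalRingHom_eval]
    exact h.left
  · simp only [f, dif_pos h]

/-! ## Points over an algebraically closed field -/

/-- Over an algebraically closed field every `x` is the abscissa of a point of the curve (the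
Weierstrass equation is monic quadratic in `y`). [folklore] -/
theorem exists_equation [IsAlgClosed K] (x : K) : ∃ y, V.toAffine.Equation x y := by
  have hm : (V.toAffine.polynomial.map (evalRingHom x)).Monic := V.toAffine.monic_polynomial.map _
  have hdeg : (V.toAffine.polynomial.map (evalRingHom x)).natDegree = 2 := by
    rw [V.toAffine.monic_polynomial.natDegree_map, Affine.natDegree_polynomial]
  obtain ⟨y, hy⟩ := IsAlgClosed.exists_root (V.toAffine.polynomial.map (evalRingHom x)) (by
    rw [degree_eq_natDegree hm.ne_zero, hdeg]; simp)
  refine ⟨y, ?_⟩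
  change V.toAffine.polynomial.evalEval x y = 0
  rw [← map_evalRingHom_eval]
  exact hy.eq_zero

/-- An elliptic curve over an algebraically closed field has infinitely many points. [folklore] -/
theorem infinite_point [IsAlgClosed K] [V.IsElliptic] : Infinite V.toAffine.Point := by
  choose f hf using V.exists_equation
  refine Infinite.of_injective
    (fun x => Affine.Point.some x (f x) (Affine.equation_iff_nonsingular.mp (hf x))) ?_
  intro x x' h
  exact (Affine.Point.some.inj h).1

end WeierstrassCurve

namespace Literature.NumberTheory.EllipticCurves

/-- A subgroup with finite complement in an infinite group is the whole group (a coset of a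
proper subgroup misses the subgroup and is as large as it). [folklore] -/
theorem AddSubgroup.eq_top_of_finite_compl {G : Type u} [AddGroup G] [Infinite G]
    (H : AddSubgroup G) (hH : ((H : Set G)ᶜ).Finite) : H = ⊤ := by
  by_contra hne
  obtain ⟨g, hg⟩ : ∃ g : G, g ∉ H := by
    by_contra! h
    exact hne ((AddSubgroup.eq_top_iff' H).mpr h)
  have hHinf : (H : Set G).Infinite := by
    intro hfin
    have : (Set.univ : Set G).Finite := by
      rw [← Set.union_compl_self (H : Set G)]
      exact hfin.union hH
    exact Set.infinite_univ this
  refine Set.infinite_of_injOn_mapsTo (f := fun h : G => g + h) (add_right_injective g).injOn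
    ?_ hHinf hH
  intro h hh hgh
  exact hg (by simpa using H.sub_mem hgh hh)

end Literature.NumberTheory.EllipticCurves

namespace WeierstrassCurve

variable {K : Type u} [Field K] [DecidableEq K] (V : WeierstrassCurve K)

/-! ## `[p] ≠ 0` (Silverman III.4.2(a)) -/

/-- **Silverman, AEC, Prop. III.4.2(a)** for primes, over an algebraically closed field: the
multiplication-by-`p` map of an elliptic curve is not zero, i.e. some point `Q` has `p • Q ≠ O`.
Proof as printed: for `p = 2` take `Q = (x₀, y₀)` with `Ψ₂Sq(x₀) = 4x₀³ + b₂x₀² + 2b₄x₀ + b₆ ≠ 0`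
(`Ψ₂Sq ≠ 0`, as `b₂ = b₆ = 0` would force `Δ = 0` in characteristic `2`); for odd `p` a point `T`
of order `2` has `pT = T ≠ O`; if there is no point of order `2` (characteristic `2`), use the
"triplication formula": a root of `Ψ₃` gives a point of order `3`, settling `p ≠ 3`, and a
non-root of `Ψ₃` gives a point `Q` with `3Q ≠ O`. [cite: SilvermanAEC2009, Prop. III.4.2(a)] -/
theorem exists_smul_ne_zero [IsAlgClosed K] [V.IsElliptic] {p : ℕ} (hp : p.Prime) :
    ∃ Q : V.toAffine.Point, (p : ℤ) • Q ≠ 0 := by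
  have hns : ∀ {x y : K}, V.toAffine.Equation x y → V.toAffine.Nonsingular x y := fun h =>
    Affine.equation_iff_nonsingular.mp h
  rcases hp.eq_two_or_odd' with rfl | hodd
  · -- `p = 2`: a point with `ψ₂(Q) ≠ 0`
    have hΨ : V.Ψ₂Sq ≠ 0 := by
      by_cases h2 : (2 : K) = 0
      · intro h0
        rw [Ψ₂Sq] at h0
        have hb₂ : V.b₂ = 0 := by
          have := congrArg (coeff · 2) h0
          simpa [coeff_X, coeff_C, coeff_C_mul, coeff_X_pow] using this
        have hb₆ : V.b₆ = 0 := by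
          have := congrArg (coeff · 0) h0
          simpa [coeff_X, coeff_C, coeff_C_mul, coeff_X_pow] using this
        refine V.isUnit_Δ.ne_zero ?_
        rw [Δ, hb₂, hb₆]
        linear_combination (-4 * V.b₄ ^ 3) * h2
      · refine V.Ψ₂Sq_ne_zero ?_
        rw [show (4 : K) = 2 * 2 by norm_num]
        exact mul_ne_zero h2 h2
    obtain ⟨x₀, hx₀⟩ := Infinite.exists_notMem_finset V.Ψ₂Sq.roots.toFinset
    rw [Multiset.mem_toFinset, mem_roots hΨ] at hx₀
    obtain ⟨y₀, hy₀⟩ := V.exists_equation x₀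
    refine ⟨.some x₀ y₀ (hns hy₀), fun h2Q => hx₀ ?_⟩
    have h2Q' : (2 : ℤ) • (Affine.Point.some x₀ y₀ (hns hy₀) : V.toAffine.Point) = 0 := by
      exact_mod_cast h2Q
    have hψ := (two_smul_some_eq_zero_iff (hns hy₀)).mp h2Q'
    rw [IsRoot.def, ← ΨSq_two, ← V.evalEval_ψ_sq hy₀ 2, hψ, zero_pow two_ne_zero]
  · obtain ⟨k, hk⟩ := hodd
    by_cases hT : ∃ (x y : K) (h : V.toAffine.Nonsingular x y),
        (2 : ℤ) • (Affine.Point.some x y h : V.toAffine.Point) = 0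
    · -- a point `T` of order `2`: `pT = T`
      obtain ⟨x, y, h, h2⟩ := hT
      refine ⟨.some x y h, fun hpT => Affine.Point.some_ne_zero h ?_⟩
      have hp' : (p : ℤ) = k * 2 + 1 := by rw [hk]; push_cast; ring
      rwa [hp', add_smul, one_smul, mul_smul, h2, smul_zero, zero_add] at hpT
    · -- no point of order `2` (characteristic `2`): use points of order `3`
      push Not at hT
      have hy : ∀ {x y : K} (h : V.toAffine.Nonsingular x y), y ≠ V.toAffine.negY x y := by
        intro x y h hyy
        exact hT x y h (by rw [two_zsmul]; exact Affine.Point.add_self_of_Y_eq hyy)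
      have h3 : (3 : K) ≠ 0 := by
        intro h3
        have h4 : (4 : K) ≠ 0 := by
          intro h4
          apply one_ne_zero (α := K)
          linear_combination h4 - h3
        obtain ⟨x₀, hx₀⟩ := IsAlgClosed.exists_root V.Ψ₂Sq (by
          rw [degree_eq_natDegree (V.Ψ₂Sq_ne_zero h4), V.natDegree_Ψ₂Sq h4]; simp)
        obtain ⟨y₀, hy₀⟩ := V.exists_equation x₀
        refine hT x₀ y₀ (hns hy₀) ((two_smul_some_eq_zero_iff (hns hy₀)).mpr ?_)
        exact (pow_eq_zero_iff two_ne_zero).mp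
          (by rw [V.evalEval_ψ_sq hy₀ 2, ΨSq_two]; exact hx₀.eq_zero)
      by_cases hp3 : p = 3
      · subst hp3
        obtain ⟨x₀, hx₀⟩ := Infinite.exists_notMem_finset V.Ψ₃.roots.toFinset
        rw [Multiset.mem_toFinset, mem_roots (V.Ψ₃_ne_zero h3)] at hx₀
        obtain ⟨y₀, hy₀⟩ := V.exists_equation x₀
        refine ⟨.some x₀ y₀ (hns hy₀), fun h3Q => hx₀ ?_⟩
        have h3Q' : (3 : ℤ) • (Affine.Point.some x₀ y₀ (hns hy₀) : V.toAffine.Point) = 0 := by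
          exact_mod_cast h3Q
        have := (three_smul_some_eq_zero_iff (hns hy₀) (hy (hns hy₀))).mp h3Q'
        rwa [ψ_three, evalEval_C] at this
      · obtain ⟨x₀, hx₀⟩ := IsAlgClosed.exists_root V.Ψ₃ (by
          rw [degree_eq_natDegree (V.Ψ₃_ne_zero h3), V.natDegree_Ψ₃ h3]; simp)
        obtain ⟨y₀, hy₀⟩ := V.exists_equation x₀
        have h3T : (3 : ℤ) • (Affine.Point.some x₀ y₀ (hns hy₀) : V.toAffine.Point) = 0 :=
          (three_smul_some_eq_zero_iff (hns hy₀) (hy (hns hy₀))).mpr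
            (by rw [ψ_three, evalEval_C]; exact hx₀.eq_zero)
        refine ⟨.some x₀ y₀ (hns hy₀), fun hpT => ?_⟩
        have h3p : ¬3 ∣ p := fun h =>
          hp3 ((Nat.prime_dvd_prime_iff_eq Nat.prime_three hp).mp h).symm
        obtain ⟨m, hm | hm⟩ : ∃ m, p = 3 * m + 1 ∨ p = 3 * m + 2 := ⟨p / 3, by omega⟩
        · have hp' : (p : ℤ) = m * 3 + 1 := by rw [hm]; push_cast; ring
          rw [hp', add_smul, mul_smul, h3T, smul_zero, zero_add, one_smul] at hpT
          exact Affine.Point.some_ne_zero _ hpT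
        · have hp' : (p : ℤ) = m * 3 + 2 := by rw [hm]; push_cast; ring
          rw [hp', add_smul, mul_smul, h3T, smul_zero, zero_add] at hpT
          exact hT x₀ y₀ (hns hy₀) hpT

/-! ## Finiteness of `E(K)[n]` -/

/-- **Silverman, AEC, Cor. III.6.4 (finiteness part), unconditionally, over an algebraically closed
field**: for an elliptic curve `V/K`, `K = K̄`, and `n ≠ 0`, the `n`-torsion subgroup `E(K)[n]` is
finite. Proof (elementary, replacing the isogeny-degree argument of the source): by strong
induction on `|n|`; `A[ab]` is finite when `A[a]`, `A[b]` are (`Literature.NumberTheory.EllipticCurves.finite_torsionBy_mul`); for a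
prime `p`, outside the finite set `B = ⋃_{2 ≤ k ≤ p-2} E[k]` an affine point `P` is `p`-torsion iff
the universal polynomial `Z_p` vanishes at `P` (`Jacobian.smul_toAffine_eq_zero_iff`,
`evalEval_smulPoly`); `Z_p ≢ 0` on the curve, since otherwise `E[p]` would have finite complement,
hence be all of the infinite group `E(K)` (`Literature.NumberTheory.EllipticCurves.AddSubgroup.eq_top_of_finite_compl`),
contradicting `[p] ≠ 0` (`exists_smul_ne_zero`, III.4.2(a)); so its zero set is finite
(`finite_setOf_evalEval_eq_zero`). [cite: SilvermanAEC2009, Cor. III.6.4] -/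
theorem finite_torsionBy_of_isAlgClosed [IsAlgClosed K] [V.IsElliptic] {n : ℤ} (hn : n ≠ 0) :
    Finite (V.toAffine.Point[n]) := by
  suffices H : ∀ m : ℕ, m ≠ 0 → Finite (V.toAffine.Point[(m : ℤ)]) by
    rcases Int.natAbs_eq n with h | h
    · rw [h]; exact H _ (Int.natAbs_ne_zero.mpr hn)
    · rw [h, AddSubgroup.torsionBy.neg]; exact H _ (Int.natAbs_ne_zero.mpr hn)
  intro m
  induction m using Nat.strong_induction_on with
  | _ m ih =>
  intro hm0
  rcases Nat.lt_or_ge m 2 with hm | hm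
  · obtain rfl : m = 1 := by omega
    rw [Nat.cast_one]
    exact Literature.NumberTheory.EllipticCurves.finite_torsionBy_one
  by_cases hprime : m.Prime
  swap
  · -- composite
    obtain ⟨a, ⟨b, rfl⟩, ha2, ham⟩ := Nat.exists_dvd_of_not_prime2 hm hprime
    have hb0 : b ≠ 0 := right_ne_zero_of_mul hm0
    have hb : b < a * b := lt_mul_left (Nat.pos_of_ne_zero hb0) (by omega)
    rw [Nat.cast_mul]
    exact Literature.NumberTheory.EllipticCurves.finite_torsionBy_mul (ih a ham (by omega)) (ih b hb hb0)
  · -- prime `p = m`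
    set p := m with hp
    -- the finite set of `k`-torsion points, `2 ≤ k ≤ p - 2`
    set B : Set V.toAffine.Point :=
      ⋃ k ∈ Set.Icc 2 (p - 2), (V.toAffine.Point[(k : ℤ)] : Set V.toAffine.Point) with hB
    have hBfin : B.Finite := by
      refine Set.Finite.biUnion (Set.finite_Icc 2 (p - 2)) fun k hk => ?_
      haveI := ih k (by rw [Set.mem_Icc] at hk; omega) (by rw [Set.mem_Icc] at hk; omega)
      exact Set.toFinite _
    -- generic points: `p • P = 0 ↔ Z_p(P) = 0`
    obtain ⟨g, hg⟩ : ∃ g : K[X][Y], g = V.smulPoly p 2 := ⟨_, rfl⟩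
    have key : ∀ {x y : K} (h : V.toAffine.Nonsingular x y), Affine.Point.some x y h ∉ B →
        ((p : ℤ) • (Affine.Point.some x y h : V.toAffine.Point) = 0 ↔ g.evalEval x y = 0) := by
      intro x y h hPB
      have hP : Jacobian.Nonsingular V ![x, y, 1] := (Jacobian.nonsingular_some x y).mpr h
      have hto : Jacobian.Point.toAffine V ![x, y, 1] = Affine.Point.some x y h :=
        Jacobian.Point.toAffine_some hP
      have hgen : ∀ k : ℕ, 2 ≤ k → k + 2 ≤ p → k • Jacobian.Point.toAffine V ![x, y, 1] ≠ 0 := by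
        intro k hk2 hkp hk0
        refine hPB (Set.mem_biUnion (Set.mem_Icc.mpr ⟨hk2, by omega⟩) ?_)
        rw [hto] at hk0
        change Affine.Point.some x y h ∈ V.toAffine.Point[(k : ℤ)]
        rw [Literature.NumberTheory.EllipticCurves.mem_torsionBy_iff, natCast_zsmul]
        exact hk0
      have e := Jacobian.smul_toAffine_eq_zero_iff hP one_ne_zero p hgen
      rw [hto, ← natCast_zsmul, ← evalEval_smulPoly_apply, ← hg] at e
      exact e
    -- `Z_p` is not zero on the curve
    have hg0 : Affine.CoordinateRing.mk V g ≠ 0 := by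
      intro h0
      have hall : ∀ {x y : K} (h : V.toAffine.Nonsingular x y), g.evalEval x y = 0 := by
        intro x y h
        obtain ⟨r, hr⟩ := AdjoinRoot.mk_eq_zero.mp h0
        have hxy : V.toAffine.polynomial.evalEval x y = 0 := h.left
        rw [hr, evalEval_mul, hxy, zero_mul]
      -- the complement of `E[p]` lies in `B`
      have hcompl : ((V.toAffine.Point[(p : ℤ)] : Set V.toAffine.Point)ᶜ).Finite := by
        refine hBfin.subset fun P hP => ?_
        rw [Set.mem_compl_iff, SetLike.mem_coe, Literature.NumberTheory.EllipticCurves.mem_torsionBy_iff] at hP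
        rcases P with _ | ⟨x, y, h⟩
        · exact (hP (by rw [← Affine.Point.zero_def, smul_zero])).elim
        · by_contra hPB
          exact hP ((key h hPB).mpr (hall h))
      haveI := V.infinite_point
      have htop := Literature.NumberTheory.EllipticCurves.AddSubgroup.eq_top_of_finite_compl _ hcompl
      obtain ⟨Q, hQ⟩ := V.exists_smul_ne_zero hprime
      exact hQ (Literature.NumberTheory.EllipticCurves.mem_torsionBy_iff.mp (htop ▸ AddSubgroup.mem_top Q))
    -- `E[p] ⊆ {O} ∪ B ∪ {Z_p = 0}`
    have hfin : ((V.toAffine.Point[(p : ℤ)] : Set V.toAffine.Point)).Finite := by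
      refine (((Set.finite_singleton (0 : V.toAffine.Point)).union hBfin).union
        (V.finite_setOf_evalEval_eq_zero hg0)).subset fun P hP => ?_
      rw [SetLike.mem_coe, Literature.NumberTheory.EllipticCurves.mem_torsionBy_iff] at hP
      rcases P with _ | ⟨x, y, h⟩
      · exact Or.inl (Or.inl Affine.Point.zero_def.symm)
      · by_cases hPB : Affine.Point.some x y h ∈ B
        · exact Or.inl (Or.inr hPB)
        · exact Or.inr ⟨x, y, h, rfl, (key h hPB).mp hP⟩
    exact hfin.to_subtype

/-! ## Descent to an arbitrary field -/

variable {F : Type u} [Field F] (W : WeierstrassCurve F) (L : Type u) [Field L] [Algebra F L]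
  [DecidableEq L] [DecidableEq (AlgebraicClosure L)]

/-- **Silverman, AEC, Cor. III.6.4 (finiteness of `E(L)[n]`)**, unconditionally: for an elliptic
curve `W` over a field `F`, a field extension `L/F` and `n ≠ 0`, the `n`-torsion subgroup `E(L)[n]`
of the `L`-rational points is finite (`E(L) ↪ E(L̄)` and `finite_torsionBy_of_isAlgClosed`).
This is `WeierstrassCurve.finite_torsionPoints W L` of `GaloisAction.lean`, unfolded.
[cite: SilvermanAEC2009, Cor. III.6.4] -/
theorem finite_torsionBy_baseChange [W.IsElliptic] {n : ℤ} (hn : n ≠ 0) :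
    Finite ((W.baseChange L).toAffine.Point[n]) :=
  Literature.NumberTheory.EllipticCurves.finite_torsionBy_of_injective
    (Affine.Point.map (W' := W.toAffine) (IsScalarTower.toAlgHom F L (AlgebraicClosure L)))
    (Affine.Point.map_injective _) n
    (finite_torsionBy_of_isAlgClosed (V := W.baseChange (AlgebraicClosure L)) hn)

end WeierstrassCurve
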